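import Literature.MathematicalPhysics.QuantumFieldTheory.Balaban1983to89.Beta.CompositionSingular

/-!
# `BalabanUV.Beta.RelInvCombBorderedKKT` — binder row D1: **THE FOUR RELATIVE-INVERSE RULES WITH RESPECT TO A COORDINATE PROJECTOR ARE
# EXACTLY «THE DRESSED PACK IS THE `(ν ⊕ μ)`-CORNER OF THE INVERSE OF THE COMB-BORDERED KKT MATRIX»** (finite-dimensional; explicit bordered
# inverse, converse, uniqueness, and the `kkt K (fromRows Q τ)` form)
# (β sub-cell, BINDER-OWNERS row D1 OWNER, lineage an2 gen 23; answers road «BF-x» K-ASSEMBLY-SPEC v1 question TB1-Q, journal l.20733)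

HONEST FRAMING (cell charter, verbatim): «discharging BetaPertH makes Balaban's UV stability UNCONDITIONAL — a real
constructive-QFT result; it is NOT the continuum limit and NOT the Clay problem.»
HONEST DEPENDENCY: continuum YM on T⁴ ⇐ BetaPertH ∧ nine spine estimates (0/9 proved); BetaPertH ⇐ (D1) ∧ (D4) ∧ CAP+tail;
G-an2-4 gates asym, D1 and NE2/3/4.
ABSOLUTE RULE (cell, verbatim): «No internally-minted statement may enter as a cited fact. Every hypothesis is either kernel-proved in this
package or a verbatim quotation of a PUBLISHED theorem with page reference. The manuscript(s) under audit are NOT citable for their own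
disputed steps — they are the thing under adjudication; programme-internal (2001/route/tribunal) claims are never citable.»
NOTHING below is cited: no `[cite: …]`, no `def`, no `Prop` fact.  Every declaration is [folklore] linear algebra over a field (Mathlib block
matrices + b12∕an2's `Composition.kkt`, `CompositionSingular.flucCov ∕ minOp ∕ minOpL ∕ effForm` BY NAME).  It asserts nothing about Bałaban's objects.

WHY (row-D1 owner, gen 23).  The wall's one-step resolvents are CO-DRESSED: `G := Π̂_bm·KInv·Π̂_bmᵀ` is NOT a two-sided inverse of the undressed
gauge-invariant bordered Hessian `𝕄 := bhK = [[d*d, −𝒬ᵀ],[𝒬, 0]]` but a RELATIVE inverse with respect to the coordinate projector `E := axEc` onto the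
axial-gauge-fixed subspace — the four rules `E∘G = G = G∘E`, `(G∘𝕄)∘E = E = (E∘𝕄)∘G` (`ChartConjugationRelative.RelInv`; DISCHARGED at `j = 0` for
every block side and in-block root by an2-g13's `RelInvBorderedHessian.relInv_coDressKBmAt_KInv`, and for every step `j` by gen 15's chain).  Road «BF-x»
(binder `D1Rep`, EXIT-A) works on cubic tori with DETERMINANTS of KKT matrices and asks (K-ASSEMBLY-SPEC v1, brick TB1, question TB1-Q): is the
statement «the dressed pack is a TWO-SIDED inverse of the COMB-bordered operator `[[S, 𝒬ᵀ, τᵀ],[𝒬, 0, 0],[τ, 0, 0]]`» available?  In the tree it is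
not (only the 2 × 2 relative form).  THIS FILE is the finite-dimensional bridge, in both directions: for a COORDINATE complement `T` (`Tᵀ·T = 1`,
`E = 1 − T·Tᵀ` — e.g. `T = [τᵀ; 0]` for the comb functional `τ` with `τ·τᵀ = 1`), the four relative rules for `(A, 𝕄, E)` hold IFF the comb-bordered
matrix `[[𝕄, T],[Tᵀ, 0]]` is invertible with `A` the `(ν ⊕ μ)`-corner of its inverse; the inverse is EXPLICIT,
`[[A, T − A𝕄T],[Tᵀ − Tᵀ𝕄A, Tᵀ𝕄A𝕄T − Tᵀ𝕄T]]`, and `A` is UNIQUE given the rules.  So on each torus the periodised relative rules pin `M_T⁻¹`'s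
`(ν ⊕ μ)`-blocks with no appeal to finite uniqueness beyond `Matrix.mul_eq_one_comm`, and conversely any invertible comb-bordered KKT matrix hands
back a relative inverse.  The ℤ⁴ (tempered-kernel) two-sided statement is NOT here and is not needed for the torus route.

WHAT (all [folklore]):
§1 GENERIC (`M A E : Matrix α α 𝕜`, `T : Matrix α γ 𝕜`, `Tᵀ·T = 1`, `E = 1 − T·Tᵀ`): `E_mul_T`, `Tt_mul_E`, `E_idem`, `E_transpose`;
   **`combBordered_mul`** (`[[M,T],[Tᵀ,0]]·[[A, T − AMT],[Tᵀ − TᵀMA, TᵀMAMT − TᵀMT]] = 1` from ONLY `E·A = A` and `E·M·A = E`),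
   **`mul_combBordered`** (the left identity from ONLY `A·E = A` and `A·M·E = E`), `isUnit_det_combBordered`, **`inv_combBordered`**,
   `toBlocks₁₁_inv_combBordered` (the corner IS `A`), **`relInv_of_isUnit_det_combBordered`** (CONVERSE: the corner of the inverse satisfies all four
   rules), **`relInv_unique`** (`A·E = A`, `A·M·E = E`, `E·A′ = A′`, `E·M·A′ = E` ⟹ `A = A′`).
§2 THE KKT FORM (`K : Matrix ν ν 𝕜`, `Q : Matrix μ ν 𝕜`, comb functional `τ : Matrix ρ ν 𝕜` with `τ·τᵀ = 1`; `E := fromBlocks (1 − τᵀτ) 0 0 1`,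
   `𝕄 := kkt K Q`): `kkt_fromRows_submatrix_sumAssoc` (`kkt K (fromRows Q τ)` IS `[[kkt K Q, [τᵀ;0]],[[τ 0], 0]]` up to `Equiv.sumAssoc`),
   **`isUnit_det_kkt_fromRows_of_relInv`**, **`blocks_kkt_fromRows_of_relInv`** (`flucCov K (fromRows Q τ) = A₁₁`, `(minOp …).toCols₁ = A₁₂`,
   `(minOpL …).toRows₁ = A₂₁`, `(effForm …).toBlocks₁₁ = −A₂₂` — «the `(ν ⊕ μ)`-blocks of `M_T⁻¹` are the dressed pack»),
   **`relInv_blocks_kkt_fromRows`** (CONVERSE: for ANY invertible `kkt K (fromRows Q τ)` with `τ·τᵀ = 1` those four blocks satisfy the rules).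
Provenance: β sub-cell, unit beta-an2 gen 23 (prover-b2b-balaban-beta-an2-g23-0), 2026-08-20.  NOT D1Rep, NOT D1, NOT `BetaPertH`, NOT continuum, NOT Clay.
-/

namespace Summit.QuantumFields.BalabanUV.Beta.RelInvCombBorderedKKT

open scoped Matrix
open Matrix
open Literature.MathematicalPhysics.QuantumFieldTheory.Balaban1983to89.Beta.Composition (kkt)
open Literature.MathematicalPhysics.QuantumFieldTheory.Balaban1983to89.Beta.CompositionSingular (flucCov minOp minOpL effForm
  kktInv_eq_fromBlocks kkt_eq_fromBlocks)

variable {𝕜 : Type*} [Field 𝕜]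

/-! ## §1 Generic: relative inverse w.r.t. a coordinate projector ⟺ corner of the comb-bordered inverse -/

section Generic

variable {α γ : Type*} [Fintype α] [Fintype γ] [DecidableEq α] [DecidableEq γ]
variable {M A E : Matrix α α 𝕜} {T : Matrix α γ 𝕜}

/-- [folklore] A coordinate projector kills its complement's columns: `E·T = 0` (`Tᵀ·T = 1`, `E = 1 − T·Tᵀ`). -/
theorem E_mul_T (hT : Tᵀ * T = 1) (hE : E = 1 - T * Tᵀ) : E * T = 0 := by
  rw [hE, Matrix.sub_mul, Matrix.one_mul, Matrix.mul_assoc, hT, Matrix.mul_one, sub_self]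

/-- [folklore] … and its complement's rows: `Tᵀ·E = 0`. -/
theorem Tt_mul_E (hT : Tᵀ * T = 1) (hE : E = 1 - T * Tᵀ) : Tᵀ * E = 0 := by
  rw [hE, Matrix.mul_sub, Matrix.mul_one, ← Matrix.mul_assoc, hT, Matrix.one_mul, sub_self]

/-- [folklore] `E` is idempotent. -/
theorem E_idem (hT : Tᵀ * T = 1) (hE : E = 1 - T * Tᵀ) : E * E = E := by
  have h := E_mul_T hT hE
  have e : E * E = E * (1 - T * Tᵀ) := by rw [← hE]
  rw [e, Matrix.mul_sub, Matrix.mul_one, ← Matrix.mul_assoc, h, Matrix.zero_mul, sub_zero]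

omit [Fintype α] [DecidableEq γ] in
/-- [folklore] `E` is symmetric. -/
theorem E_transpose (hE : E = 1 - T * Tᵀ) : Eᵀ = E := by
  rw [hE, transpose_sub, transpose_one, transpose_mul, transpose_transpose]

/-- [folklore] **THE COMB-BORDERED MATRIX TIMES THE CANDIDATE INVERSE IS `1`** — from ONLY the two rules `E·A = A`, `E·𝕄·A = E`
(with `Tᵀ·T = 1`, `E = 1 − T·Tᵀ`):
`[[𝕄, T],[Tᵀ, 0]] · [[A, T − A𝕄T],[Tᵀ − Tᵀ𝕄A, Tᵀ𝕄A𝕄T − Tᵀ𝕄T]] = 1`. -/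
theorem combBordered_mul (hT : Tᵀ * T = 1) (hE : E = 1 - T * Tᵀ) (hEA : E * A = A) (hEMA : E * M * A = E) :
    fromBlocks M T Tᵀ (0 : Matrix γ γ 𝕜) *
        fromBlocks A (T - A * M * T) (Tᵀ - Tᵀ * M * A) (Tᵀ * M * A * M * T - Tᵀ * M * T) = 1 := by
  have hTE : Tᵀ * E = 0 := Tt_mul_E hT hE
  have hTA : Tᵀ * A = 0 := by rw [← hEA, ← Matrix.mul_assoc, hTE, Matrix.zero_mul]
  have hTT : T * Tᵀ = 1 - E := by rw [hE, sub_sub_cancel]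
  rw [fromBlocks_multiply, ← fromBlocks_one]
  congr 1
  · -- `M·A + T·(Tᵀ − Tᵀ𝕄A) = 1`
    rw [Matrix.mul_sub, ← Matrix.mul_assoc, ← Matrix.mul_assoc, hTT, Matrix.sub_mul, Matrix.sub_mul, Matrix.one_mul, hEMA]
    abel
  · -- `M·(T − A𝕄T) + T·(Tᵀ𝕄A𝕄T − Tᵀ𝕄T) = 0`
    have e1 : T * (Tᵀ * M * A * M * T - Tᵀ * M * T) = (T * Tᵀ) * (M * A * M * T) - (T * Tᵀ) * (M * T) := by
      rw [Matrix.mul_sub]; simp only [Matrix.mul_assoc]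
    rw [e1, hTT, Matrix.sub_mul, Matrix.sub_mul, Matrix.one_mul, Matrix.one_mul, Matrix.mul_sub]
    have e2 : E * (M * A * M * T) = E * M * T := by
      rw [show M * A * M * T = M * A * (M * T) by simp only [Matrix.mul_assoc], ← Matrix.mul_assoc,
        show E * (M * A) = E * M * A by rw [Matrix.mul_assoc], hEMA, Matrix.mul_assoc]
    rw [e2, show M * (A * M * T) = M * A * M * T by simp only [Matrix.mul_assoc],
      show E * (M * T) = E * M * T by rw [Matrix.mul_assoc]]
    abel
  · -- `Tᵀ·A + 0 = 0`
    rw [hTA, Matrix.zero_mul, add_zero]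
  · -- `Tᵀ·(T − A𝕄T) + 0 = 1`
    rw [Matrix.zero_mul, add_zero, Matrix.mul_sub, hT,
      show Tᵀ * (A * M * T) = Tᵀ * A * (M * T) by simp only [Matrix.mul_assoc], hTA, Matrix.zero_mul, sub_zero]

/-- [folklore] **THE CANDIDATE INVERSE TIMES THE COMB-BORDERED MATRIX IS `1`** — from ONLY the two rules `A·E = A`, `A·𝕄·E = E`. -/
theorem mul_combBordered (hT : Tᵀ * T = 1) (hE : E = 1 - T * Tᵀ) (hAE : A * E = A) (hAME : A * M * E = E) :
    fromBlocks A (T - A * M * T) (Tᵀ - Tᵀ * M * A) (Tᵀ * M * A * M * T - Tᵀ * M * T) *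
        fromBlocks M T Tᵀ (0 : Matrix γ γ 𝕜) = 1 := by
  have hET : E * T = 0 := E_mul_T hT hE
  have hAT : A * T = 0 := by rw [← hAE, Matrix.mul_assoc, hET, Matrix.mul_zero]
  have hTT : T * Tᵀ = 1 - E := by rw [hE, sub_sub_cancel]
  rw [fromBlocks_multiply, ← fromBlocks_one]
  congr 1
  · -- `A·M + (T − A𝕄T)·Tᵀ = 1`
    rw [Matrix.sub_mul, show A * M * T * Tᵀ = A * M * (T * Tᵀ) by simp only [Matrix.mul_assoc], hTT, Matrix.mul_sub,
      Matrix.mul_one, hAME]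
    abel
  · -- `A·T + (T − A𝕄T)·0 = 0`
    rw [hAT, Matrix.mul_zero, add_zero]
  · -- `(Tᵀ − Tᵀ𝕄A)·M + (Tᵀ𝕄A𝕄T − Tᵀ𝕄T)·Tᵀ = 0`
    rw [Matrix.sub_mul, Matrix.sub_mul,
      show Tᵀ * M * A * M * T * Tᵀ = Tᵀ * M * A * M * (T * Tᵀ) by simp only [Matrix.mul_assoc],
      show Tᵀ * M * T * Tᵀ = Tᵀ * M * (T * Tᵀ) by simp only [Matrix.mul_assoc], hTT, Matrix.mul_sub, Matrix.mul_sub,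
      Matrix.mul_one, Matrix.mul_one, show Tᵀ * M * A * M * E = Tᵀ * M * (A * M * E) by simp only [Matrix.mul_assoc], hAME]
    abel
  · -- `(Tᵀ − Tᵀ𝕄A)·T + 0 = 1`
    rw [Matrix.mul_zero, add_zero, Matrix.sub_mul, hT,
      show Tᵀ * M * A * T = Tᵀ * M * (A * T) by simp only [Matrix.mul_assoc], hAT, Matrix.mul_zero, sub_zero]

/-- [folklore] Hence the comb-bordered matrix is INVERTIBLE (from `E·A = A`, `E·𝕄·A = E` alone). -/
theorem isUnit_det_combBordered (hT : Tᵀ * T = 1) (hE : E = 1 - T * Tᵀ) (hEA : E * A = A) (hEMA : E * M * A = E) :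
    IsUnit (fromBlocks M T Tᵀ (0 : Matrix γ γ 𝕜)).det :=
  isUnit_det_of_right_inverse (combBordered_mul hT hE hEA hEMA)

/-- [folklore] **THE COMB-BORDERED INVERSE, EXPLICITLY**: `[[𝕄, T],[Tᵀ, 0]]⁻¹ = [[A, T − A𝕄T],[Tᵀ − Tᵀ𝕄A, Tᵀ𝕄A𝕄T − Tᵀ𝕄T]]`
(from `E·A = A`, `E·𝕄·A = E`; square matrices over a field, so the right inverse is the inverse). -/
theorem inv_combBordered (hT : Tᵀ * T = 1) (hE : E = 1 - T * Tᵀ) (hEA : E * A = A) (hEMA : E * M * A = E) :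
    (fromBlocks M T Tᵀ (0 : Matrix γ γ 𝕜))⁻¹ =
      fromBlocks A (T - A * M * T) (Tᵀ - Tᵀ * M * A) (Tᵀ * M * A * M * T - Tᵀ * M * T) :=
  inv_eq_right_inv (combBordered_mul hT hE hEA hEMA)

/-- [folklore] **THE `(ν ⊕ μ)`-CORNER OF THE COMB-BORDERED INVERSE IS THE RELATIVE INVERSE `A`.** -/
theorem toBlocks₁₁_inv_combBordered (hT : Tᵀ * T = 1) (hE : E = 1 - T * Tᵀ) (hEA : E * A = A) (hEMA : E * M * A = E) :
    ((fromBlocks M T Tᵀ (0 : Matrix γ γ 𝕜))⁻¹).toBlocks₁₁ = A := by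
  rw [inv_combBordered hT hE hEA hEMA, toBlocks_fromBlocks₁₁]

/-- [folklore] The other three blocks of the comb-bordered inverse in terms of `A` (the comb column, the comb row, the comb–comb block). -/
theorem toBlocks_inv_combBordered (hT : Tᵀ * T = 1) (hE : E = 1 - T * Tᵀ) (hEA : E * A = A) (hEMA : E * M * A = E) :
    ((fromBlocks M T Tᵀ (0 : Matrix γ γ 𝕜))⁻¹).toBlocks₁₂ = T - A * M * T ∧
      ((fromBlocks M T Tᵀ (0 : Matrix γ γ 𝕜))⁻¹).toBlocks₂₁ = Tᵀ - Tᵀ * M * A ∧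
        ((fromBlocks M T Tᵀ (0 : Matrix γ γ 𝕜))⁻¹).toBlocks₂₂ = Tᵀ * M * A * M * T - Tᵀ * M * T := by
  rw [inv_combBordered hT hE hEA hEMA, toBlocks_fromBlocks₁₂, toBlocks_fromBlocks₂₁, toBlocks_fromBlocks₂₂]
  exact ⟨rfl, rfl, rfl⟩

/-- [folklore] From the two RIGHT rules one gets the two LEFT rules: `E·A = A ∧ E·𝕄·A = E ⟹ A·E = A ∧ A·𝕄·E = E`
(through the bordered inverse: a right inverse of a square matrix is a left inverse). -/
theorem left_rules_of_right_rules (hT : Tᵀ * T = 1) (hE : E = 1 - T * Tᵀ) (hEA : E * A = A) (hEMA : E * M * A = E) :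
    A * E = A ∧ A * M * E = E := by
  have h := mul_eq_one_comm.1 (combBordered_mul hT hE hEA hEMA)
  rw [fromBlocks_multiply, ← fromBlocks_one, fromBlocks_inj] at h
  obtain ⟨h11, h12, -, -⟩ := h
  have hTT : T * Tᵀ = 1 - E := by rw [hE, sub_sub_cancel]
  -- (1,2): `A·T + (T − A𝕄T)·0 = 0`
  rw [Matrix.mul_zero, add_zero] at h12
  have hAE : A * E = A := by
    rw [hE, Matrix.mul_sub, Matrix.mul_one, ← Matrix.mul_assoc, h12, Matrix.zero_mul, sub_zero]
  refine ⟨hAE, ?_⟩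
  -- (1,1): `A·M + (T − A𝕄T)·Tᵀ = 1`
  rw [Matrix.sub_mul, show A * M * T * Tᵀ = A * M * (T * Tᵀ) by simp only [Matrix.mul_assoc], ← sub_eq_zero] at h11
  rw [hE, Matrix.mul_sub, Matrix.mul_one, ← sub_eq_zero]
  have e : A * M - A * M * (T * Tᵀ) - (1 - T * Tᵀ) = A * M + (T * Tᵀ - A * M * (T * Tᵀ)) - 1 := by abel
  rw [e, h11]

/-- [folklore] **CONVERSE: ANY INVERTIBLE COMB-BORDERED MATRIX HANDS BACK A RELATIVE INVERSE** — if `[[𝕄, T],[Tᵀ, 0]]` is invertible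
(`Tᵀ·T = 1`, `E = 1 − T·Tᵀ`), the `(ν ⊕ μ)`-corner `A` of its inverse satisfies all four rules `E·A = A`, `A·E = A`, `A·𝕄·E = E`, `E·𝕄·A = E`. -/
theorem relInv_of_isUnit_det_combBordered (hT : Tᵀ * T = 1) (hE : E = 1 - T * Tᵀ)
    (h : IsUnit (fromBlocks M T Tᵀ (0 : Matrix γ γ 𝕜)).det) :
    E * ((fromBlocks M T Tᵀ (0 : Matrix γ γ 𝕜))⁻¹).toBlocks₁₁ = ((fromBlocks M T Tᵀ (0 : Matrix γ γ 𝕜))⁻¹).toBlocks₁₁ ∧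
      ((fromBlocks M T Tᵀ (0 : Matrix γ γ 𝕜))⁻¹).toBlocks₁₁ * E = ((fromBlocks M T Tᵀ (0 : Matrix γ γ 𝕜))⁻¹).toBlocks₁₁ ∧
        ((fromBlocks M T Tᵀ (0 : Matrix γ γ 𝕜))⁻¹).toBlocks₁₁ * M * E = E ∧
          E * M * ((fromBlocks M T Tᵀ (0 : Matrix γ γ 𝕜))⁻¹).toBlocks₁₁ = E := by
  set B := (fromBlocks M T Tᵀ (0 : Matrix γ γ 𝕜))⁻¹ with hB
  have hR : fromBlocks M T Tᵀ (0 : Matrix γ γ 𝕜) * B = 1 := Matrix.mul_nonsing_inv _ h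
  have hL : B * fromBlocks M T Tᵀ (0 : Matrix γ γ 𝕜) = 1 := Matrix.nonsing_inv_mul _ h
  conv_lhs at hR => rw [← fromBlocks_toBlocks B]
  conv_lhs at hL => rw [← fromBlocks_toBlocks B]
  rw [fromBlocks_multiply, ← fromBlocks_one, fromBlocks_inj] at hR hL
  obtain ⟨r11, -, r21, -⟩ := hR
  obtain ⟨l11, l12, -, -⟩ := hL
  -- r11 : M·B₁₁ + T·B₂₁ = 1 ;  r21 : Tᵀ·B₁₁ + 0·B₂₁ = 0 ; l11 : B₁₁·M + B₁₂·Tᵀ = 1 ; l12 : B₁₁·T + B₁₂·0 = 0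
  rw [Matrix.zero_mul, add_zero] at r21
  rw [Matrix.mul_zero, add_zero] at l12
  have hEA : E * B.toBlocks₁₁ = B.toBlocks₁₁ := by
    rw [hE, Matrix.sub_mul, Matrix.one_mul, Matrix.mul_assoc, r21, Matrix.mul_zero, sub_zero]
  have hAE : B.toBlocks₁₁ * E = B.toBlocks₁₁ := by
    rw [hE, Matrix.mul_sub, Matrix.mul_one, ← Matrix.mul_assoc, l12, Matrix.zero_mul, sub_zero]
  refine ⟨hEA, hAE, ?_, ?_⟩
  · -- `B₁₁·M·E = E`
    have e : B.toBlocks₁₁ * M = 1 - B.toBlocks₁₂ * Tᵀ := eq_sub_of_add_eq l11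
    rw [e, Matrix.sub_mul, Matrix.one_mul, Matrix.mul_assoc, Tt_mul_E hT hE, Matrix.mul_zero, sub_zero]
  · -- `E·M·B₁₁ = E`
    have e : M * B.toBlocks₁₁ = 1 - T * B.toBlocks₂₁ := eq_sub_of_add_eq r11
    rw [Matrix.mul_assoc, e, Matrix.mul_sub, Matrix.mul_one, ← Matrix.mul_assoc, E_mul_T hT hE, Matrix.zero_mul, sub_zero]

omit [Fintype γ] [DecidableEq γ] [DecidableEq α] in
/-- [folklore] **UNIQUENESS OF THE RELATIVE INVERSE**: `A·E = A`, `A·𝕄·E = E` and `E·A′ = A′`, `E·𝕄·A′ = E` force `A = A′`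
(both equal `A·𝕄·A′`; no `T` needed). -/
theorem relInv_unique {A' : Matrix α α 𝕜} (hAE : A * E = A) (hAME : A * M * E = E) (hEA' : E * A' = A')
    (hEMA' : E * M * A' = E) : A = A' := by
  have h1 : A = A * M * A' := by
    calc A = A * E := hAE.symm
      _ = A * (E * M * A') := by rw [hEMA']
      _ = A * E * M * A' := by simp only [Matrix.mul_assoc]
      _ = A * M * A' := by rw [hAE]
  have h2 : A' = A * M * A' := by
    calc A' = E * A' := hEA'.symm
      _ = A * M * E * A' := by rw [hAME]
      _ = A * M * (E * A') := by simp only [Matrix.mul_assoc]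
      _ = A * M * A' := by rw [hEA']
  rw [h1, ← h2]

end Generic

/-! ## §2 The KKT form: `𝕄 := kkt K Q`, comb functional `τ` with `τ·τᵀ = 1`, `E := fromBlocks (1 − τᵀτ) 0 0 1`, `T := [τᵀ; 0]` -/

section KKT

variable {ν μ ρ : Type*} [Fintype ν] [Fintype μ] [Fintype ρ] [DecidableEq ν] [DecidableEq μ] [DecidableEq ρ]
variable (K : Matrix ν ν 𝕜) (Q : Matrix μ ν 𝕜) (τ : Matrix ρ ν 𝕜)

omit [Fintype ρ] [DecidableEq ν] [DecidableEq μ] [DecidableEq ρ] in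
/-- [folklore] The stacked column `T := [τᵀ; 0]` is a coordinate complement: `Tᵀ·T = τ·τᵀ`. -/
theorem transpose_fromRows_mul_fromRows :
    (fromRows τᵀ (0 : Matrix μ ρ 𝕜))ᵀ * fromRows τᵀ (0 : Matrix μ ρ 𝕜) = τ * τᵀ := by
  rw [transpose_fromRows, transpose_transpose, transpose_zero, fromCols_mul_fromRows, Matrix.zero_mul, add_zero]

omit [Fintype ν] [Fintype μ] [DecidableEq ρ] in
/-- [folklore] … and its projector is `1 − T·Tᵀ = fromBlocks (1 − τᵀτ) 0 0 1` (the field block is gauge-projected, the multiplier block untouched). -/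
theorem one_sub_fromRows_mul_transpose :
    (1 : Matrix (ν ⊕ μ) (ν ⊕ μ) 𝕜) - fromRows τᵀ (0 : Matrix μ ρ 𝕜) * (fromRows τᵀ (0 : Matrix μ ρ 𝕜))ᵀ =
      fromBlocks (1 - τᵀ * τ) 0 0 (1 : Matrix μ μ 𝕜) := by
  rw [transpose_fromRows, transpose_transpose, transpose_zero, fromRows_mul_fromCols, Matrix.mul_zero, Matrix.zero_mul,
    Matrix.zero_mul, ← fromBlocks_one, sub_eq_add_neg, fromBlocks_neg, fromBlocks_add]
  simp only [neg_zero, add_zero, ← sub_eq_add_neg]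

omit [Fintype ν] [Fintype μ] [Fintype ρ] [DecidableEq ν] [DecidableEq μ] [DecidableEq ρ] in
/-- [folklore] **`kkt K (fromRows Q τ)` IS THE COMB-BORDERED `kkt K Q`** up to the re-association `(ν ⊕ μ) ⊕ ρ ≃ ν ⊕ (μ ⊕ ρ)`:
`(kkt K (fromRows Q τ)).submatrix sumAssoc sumAssoc = [[kkt K Q, [τᵀ; 0]],[[τ 0], 0]]`. -/
theorem kkt_fromRows_submatrix_sumAssoc :
    (kkt K (fromRows Q τ)).submatrix (Equiv.sumAssoc ν μ ρ) (Equiv.sumAssoc ν μ ρ) =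
      fromBlocks (kkt K Q) (fromRows τᵀ (0 : Matrix μ ρ 𝕜)) (fromRows τᵀ (0 : Matrix μ ρ 𝕜))ᵀ 0 := by
  ext ((i | j) | k) ((i' | j') | k') <;> rfl

/-- [folklore] **ROAD BF-x's TB1, finite-dimensional core: THE RELATIVE RULES MAKE `kkt K (fromRows Q τ)` INVERTIBLE** — if `τ·τᵀ = 1` and
`A : Matrix (ν ⊕ μ) (ν ⊕ μ) 𝕜` satisfies `E·A = A`, `E·(kkt K Q)·A = E` for `E := fromBlocks (1 − τᵀτ) 0 0 1`, then `IsUnit (kkt K (fromRows Q τ)).det`. -/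
theorem isUnit_det_kkt_fromRows_of_relInv (hτ : τ * τᵀ = 1) {A : Matrix (ν ⊕ μ) (ν ⊕ μ) 𝕜}
    (hEA : fromBlocks (1 - τᵀ * τ) 0 0 (1 : Matrix μ μ 𝕜) * A = A)
    (hEMA : fromBlocks (1 - τᵀ * τ) 0 0 (1 : Matrix μ μ 𝕜) * kkt K Q * A = fromBlocks (1 - τᵀ * τ) 0 0 (1 : Matrix μ μ 𝕜)) :
    IsUnit (kkt K (fromRows Q τ)).det := by
  have hT : (fromRows τᵀ (0 : Matrix μ ρ 𝕜))ᵀ * fromRows τᵀ (0 : Matrix μ ρ 𝕜) = 1 := by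
    rw [transpose_fromRows_mul_fromRows, hτ]
  have hE := (one_sub_fromRows_mul_transpose (μ := μ) τ).symm
  have h := isUnit_det_combBordered (M := kkt K Q) hT hE hEA hEMA
  rwa [← kkt_fromRows_submatrix_sumAssoc, det_submatrix_equiv_self] at h

/-- [folklore] **ROAD BF-x's TB1, finite-dimensional core: THE `(ν ⊕ μ)`-BLOCKS OF `(kkt K (fromRows Q τ))⁻¹` ARE THE RELATIVE INVERSE** —
under the same two rules: `flucCov K (fromRows Q τ) = A₁₁`, `(minOp K (fromRows Q τ)).toCols₁ = A₁₂`, `(minOpL K (fromRows Q τ)).toRows₁ = A₂₁`,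
`(effForm K (fromRows Q τ)).toBlocks₁₁ = −A₂₂`. -/
theorem blocks_kkt_fromRows_of_relInv (hτ : τ * τᵀ = 1) {A : Matrix (ν ⊕ μ) (ν ⊕ μ) 𝕜}
    (hEA : fromBlocks (1 - τᵀ * τ) 0 0 (1 : Matrix μ μ 𝕜) * A = A)
    (hEMA : fromBlocks (1 - τᵀ * τ) 0 0 (1 : Matrix μ μ 𝕜) * kkt K Q * A = fromBlocks (1 - τᵀ * τ) 0 0 (1 : Matrix μ μ 𝕜)) :
    flucCov K (fromRows Q τ) = A.toBlocks₁₁ ∧ (minOp K (fromRows Q τ)).toCols₁ = A.toBlocks₁₂ ∧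
      (minOpL K (fromRows Q τ)).toRows₁ = A.toBlocks₂₁ ∧ (effForm K (fromRows Q τ)).toBlocks₁₁ = -A.toBlocks₂₂ := by
  have hT : (fromRows τᵀ (0 : Matrix μ ρ 𝕜))ᵀ * fromRows τᵀ (0 : Matrix μ ρ 𝕜) = 1 := by
    rw [transpose_fromRows_mul_fromRows, hτ]
  have hE := (one_sub_fromRows_mul_transpose (μ := μ) τ).symm
  have hinv := inv_combBordered (M := kkt K Q) hT hE hEA hEMA
  rw [← kkt_fromRows_submatrix_sumAssoc, inv_submatrix_equiv] at hinv
  -- read the entries of `(kkt K (fromRows Q τ))⁻¹` through the re-association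
  have e : ∀ a b : ν ⊕ μ, (kkt K (fromRows Q τ))⁻¹ (Equiv.sumAssoc ν μ ρ (Sum.inl a)) (Equiv.sumAssoc ν μ ρ (Sum.inl b)) = A a b := by
    intro a b
    have := congr_fun (congr_fun hinv (Sum.inl a)) (Sum.inl b)
    rw [submatrix_apply] at this
    rw [this, fromBlocks_apply₁₁]
  refine ⟨?_, ?_, ?_, ?_⟩
  · ext i i'
    have := e (Sum.inl i) (Sum.inl i')
    simp only [Equiv.sumAssoc_apply_inl_inl] at this
    change (kkt K (fromRows Q τ))⁻¹ (Sum.inl i) (Sum.inl i') = A (Sum.inl i) (Sum.inl i')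
    exact this
  · ext i j'
    have := e (Sum.inl i) (Sum.inr j')
    simp only [Equiv.sumAssoc_apply_inl_inl, Equiv.sumAssoc_apply_inl_inr] at this
    change (kkt K (fromRows Q τ))⁻¹ (Sum.inl i) (Sum.inr (Sum.inl j')) = A (Sum.inl i) (Sum.inr j')
    exact this
  · ext j i'
    have := e (Sum.inr j) (Sum.inl i')
    simp only [Equiv.sumAssoc_apply_inl_inl, Equiv.sumAssoc_apply_inl_inr] at this
    change (kkt K (fromRows Q τ))⁻¹ (Sum.inr (Sum.inl j)) (Sum.inl i') = A (Sum.inr j) (Sum.inl i')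
    exact this
  · ext j j'
    have := e (Sum.inr j) (Sum.inr j')
    simp only [Equiv.sumAssoc_apply_inl_inr] at this
    change -((kkt K (fromRows Q τ))⁻¹ (Sum.inr (Sum.inl j)) (Sum.inr (Sum.inl j'))) = -(A (Sum.inr j) (Sum.inr j'))
    rw [this]

/-- [folklore] **CONVERSE IN KKT FORM: EVERY INVERTIBLE COMB-BORDERED KKT MATRIX HANDS BACK A RELATIVE INVERSE** — if `τ·τᵀ = 1` and
`kkt K (fromRows Q τ)` is invertible, the pack `A := fromBlocks (flucCov …) ((minOp …).toCols₁) ((minOpL …).toRows₁) (−(effForm …).toBlocks₁₁)` of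
its `(ν ⊕ μ)`-blocks satisfies `E·A = A`, `A·E = A`, `A·(kkt K Q)·E = E`, `E·(kkt K Q)·A = E` for `E := fromBlocks (1 − τᵀτ) 0 0 1`. -/
theorem relInv_blocks_kkt_fromRows (hτ : τ * τᵀ = 1) (h : IsUnit (kkt K (fromRows Q τ)).det) :
    let A : Matrix (ν ⊕ μ) (ν ⊕ μ) 𝕜 := fromBlocks (flucCov K (fromRows Q τ)) (minOp K (fromRows Q τ)).toCols₁
      (minOpL K (fromRows Q τ)).toRows₁ (-(effForm K (fromRows Q τ)).toBlocks₁₁)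
    let E : Matrix (ν ⊕ μ) (ν ⊕ μ) 𝕜 := fromBlocks (1 - τᵀ * τ) 0 0 (1 : Matrix μ μ 𝕜)
    E * A = A ∧ A * E = A ∧ A * kkt K Q * E = E ∧ E * kkt K Q * A = E := by
  intro A E
  have hT : (fromRows τᵀ (0 : Matrix μ ρ 𝕜))ᵀ * fromRows τᵀ (0 : Matrix μ ρ 𝕜) = 1 := by
    rw [transpose_fromRows_mul_fromRows, hτ]
  have hE : E = 1 - fromRows τᵀ (0 : Matrix μ ρ 𝕜) * (fromRows τᵀ (0 : Matrix μ ρ 𝕜))ᵀ :=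
    (one_sub_fromRows_mul_transpose (μ := μ) τ).symm
  have h' : IsUnit (fromBlocks (kkt K Q) (fromRows τᵀ (0 : Matrix μ ρ 𝕜)) (fromRows τᵀ (0 : Matrix μ ρ 𝕜))ᵀ 0).det := by
    rwa [← kkt_fromRows_submatrix_sumAssoc, det_submatrix_equiv_self]
  have hA : A = ((fromBlocks (kkt K Q) (fromRows τᵀ (0 : Matrix μ ρ 𝕜)) (fromRows τᵀ (0 : Matrix μ ρ 𝕜))ᵀ 0)⁻¹).toBlocks₁₁ := by
    rw [← kkt_fromRows_submatrix_sumAssoc, inv_submatrix_equiv]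
    ext a b
    rcases a with i | j <;> rcases b with i' | j'
    · rfl
    · rfl
    · rfl
    · change -(-((kkt K (fromRows Q τ))⁻¹ (Sum.inr (Sum.inl j)) (Sum.inr (Sum.inl j')))) =
        (kkt K (fromRows Q τ))⁻¹ (Sum.inr (Sum.inl j)) (Sum.inr (Sum.inl j'))
      rw [neg_neg]
  clear_value A E
  rw [hA]
  exact relInv_of_isUnit_det_combBordered hT hE h'

end KKT

end Summit.QuantumFields.BalabanUV.Beta.RelInvCombBorderedKKT
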